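import Mathlib
import Summits.ResolutionOfSingularities.ResolutionOfSingularities.Theorems.HomologicalConductorPersistenceSurfaceFiniteCover
import Summits.ResolutionOfSingularities.ResolutionOfSingularities.Theorems.HomologicalConductorPersistenceReflexiveHullTransfer
import Summits.ResolutionOfSingularities.ResolutionOfSingularities.Theorems.HomologicalConductorPersistenceConductorCeiling
import Literature.RingTheory.CohomologyAnnihilator.SyzygyDescent
import HarnessLib

/-!
# Rung S-2 `PersistenceSurface` (stmt-ResolutionOfSingularities-19970) — the (R4) ASSEMBLY as a
# conditional kernel lemma: level-`(m+1)` persistence from (IW-p) + (E-sur), exponent one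

Route `ResolutionOfSingularities/HomologicalConductor`, chain W4.4b (cell res-hironaka; seat
res-L1-w44b-stub-1 gen 5 on res-L1-w44b-lead-1's WAVE PLAN of 2026-08-27T17:22:33Z, skeleton `core` v3,
stub C2 = CSP‴, kernel side). `[OURS · L1 w44b]` replaces the role of no printed item; NOT a statement
of the manuscript under review (Hironaka 2017), nothing here is attributed to its author; folklore
homological algebra, AI-written (weaker than expert review).

Programme M-rat (res-L1-w44b-plan-1, CRUX-PLAN v5 §4.2) proves persistence `ca(T) ⊆ ca(T')` across one
step `T ⊆ T' ⊆ Frac T` of the canonical `ca`-tower at a RATIONAL surface stage by the annihilator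
transfer (R4): `x ∈ ca(T)` stably annihilates every special `T`-module `N`; base change and reflexive
hull are functorial and fix free modules, so `x` stably annihilates the hull `(T'·N)**`; by
**(E-sur)** («special restriction is surjective»: every special of `T'` is a direct summand of some
`(T'·N)**`, Wunram 1988 / IKWY 2014 over `ℂ`) and **(IW-p)** (the class inclusion
«`ΩCM(T') ⊆ add(SCM(T')*)`», Iyama–Wemyss over `ℂ`; open in characteristic `p`) every high syzygy over
`T'` is then reached, so `x ∈ ca(T')`. The kernel side of (R4) — birational transfer
(`Literature…BirationalTransfer`) and the hull lemma (`…PersistenceReflexiveHullTransfer`, idea-2) — is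
in the tree; this file is the COMPOSITION, with the two geometric premises kept as explicit,
`x`-free hypotheses on a TARGET FAMILY `S' : I → ModuleCat T'` (the specials of `T'`, their duals, …):

* (IW-p)-shape `hIW` — every `m`-th syzygy of a finitely generated `T'`-module is a `T'`-linear
  retract of a finite product `(Fin b → T') × Π j, S' (a j)` of members of the family (and a free
  module);
* (E-sur)-shape `hEsur` — every member `S' i` is a `T'`-linear retract of a finite product of HULLS of
  source modules: either the tensor hulls `(T' ⊗_T N j)**` of `T`-modules `N j` (abstract form, any
  algebra `T → T'`), or the span hulls `reflexiveHull (T'·Y₀ j) ⊆ V j` of `T`-lattices `Y₀ j` in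
  `K`-vector spaces (birational form, subalgebras `T ≤ T'` of a field `K` with `T' ⊆ Frac T`), the
  source modules being `m`-th syzygies of finitely generated `T`-modules (so that CA1 reaches them
  from `caᵐ⁺¹(T)`; at level `3` = `m = 2` these are the second-syzygy lattices, e.g. finitely
  generated REFLEXIVE lattices by lead-1's `exists_isSyzygy_two_of_isReflexive`, p553024).

Conclusion: `caᵐ⁺¹(T) · T' ⊆ caᵐ⁺¹(T')` (an inclusion of ideals, for every element at once). Pieces, all
by name: CA1 `mem_cohomologyAnnihilatorOfDegree_succ_iff_forall_isSyzygy` (W4.4, both directions),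
`StablyAnnihilates.{pi, prod, fin, of_retract_linearMap, dual_dual_baseChange}` (o1/o7,
`…PersistenceSurfaceHullCover` / `…PersistenceSurfaceFiniteCover`), the hull lemma
`Subalgebra.exists_comp_eq_smul_id_reflexiveHull_of_le_of_span_eq` (idea-2), `finite_of_isSyzygy`
(`Literature…SyzygyDescent`). Exponent one throughout; no flatness, depth or dimension hypothesis.

Contents:
* `mem_cohomologyAnnihilatorOfDegree_succ_of_addCover` / `…_of_addCover'` — TARGET SIDE: an element
  stably annihilating every member of a family that additively covers the `m`-th syzygies lies in
  `caᵐ⁺¹` (without / with a free factor in the cover);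
* `stablyAnnihilates_family_of_tensorHullCover`, `map_cohomologyAnnihilatorOfDegree_succ_le_of_tensorHullCover`
  — (E-sur) with tensor hulls, and the assembled ideal inclusion for an algebra `T → T'`;
* `Subalgebra.stablyAnnihilates_reflexiveHull_span`, `Subalgebra.stablyAnnihilates_family_of_spanHullCover`,
  `Subalgebra.inclusion_mem_cohomologyAnnihilatorOfDegree_succ_of_spanHullCover`,
  `Subalgebra.map_cohomologyAnnihilatorOfDegree_succ_le_of_spanHullCover` — the birational span-hull
  form for `B ≤ C ≤ K`, `C ⊆ Frac B`;
* `Subalgebra.inclusion_mem_cohomologyAnnihilatorOfDegree_three_of_spanHullCover` — LEVEL 3 (`m = 2`,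
  second-syzygy source lattices; the literal (R4) shape — specials are reflexive, hence second syzygies);
* (appendix) `Subalgebra.inclusion_mem_cohomologyAnnihilatorOfDegree_three_of_reflexiveSpanHullCover` —
  LEVEL 3 with finitely generated REFLEXIVE source lattices (lead-1's `exists_isSyzygy_two_of_isReflexive`).

References: S. B. Iyengar, R. Takahashi, *Annihilation of cohomology and strong generation of module
categories*, IMRN 2016, arXiv:1404.1476, §2 [`IyengarTakahashi2014`]; W. Bruns, J. Herzog,
*Cohen–Macaulay rings*, CUP 1998, Prop. 1.4.1 [`BrunsHerzog1998`]; for the premises (not used as facts):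
J. Wunram, *Reflexive modules on quotient surface singularities*, Math. Ann. 279 (1988); O. Iyama,
M. Wemyss, *The classification of special Cohen–Macaulay modules*, Math. Z. 265 (2010).
-/

-- single-problem summit: the doubled namespace component `ResolutionOfSingularities` is forced
set_option linter.dupNamespace false

noncomputable section

open CategoryTheory Literature.RingTheory.CohomologyAnnihilator Literature.RingTheory.Localization
open Summit.ResolutionOfSingularities.ResolutionOfSingularities.Theorems.NoZeno.SandwichCluster
open Summit.ResolutionOfSingularities.ResolutionOfSingularities.Theorems.HomologicalConductor.PersistenceSurfaceHullCover
open Summit.ResolutionOfSingularities.ResolutionOfSingularities.Theorems.HomologicalConductor.PersistenceSurfaceFiniteCover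
open Summit.ResolutionOfSingularities.ResolutionOfSingularities.Theorems.HomologicalConductor.PersistenceReflexiveHullTransfer
open scoped TensorProduct

universe u

namespace Summit.ResolutionOfSingularities.ResolutionOfSingularities.Theorems.HomologicalConductor.PersistenceSurfaceSpecialCoverAssembly

/-! ## Target side: membership in `caᵐ⁺¹` from an additive cover of the `m`-th syzygies ((IW-p)-shape) -/

/-- **Target side of (R4).** `T'` noetherian, `S' : I → ModuleCat T'` a family of modules each
stably annihilated by `y : T'`; if every `m`-th syzygy `L` of a finitely generated `T'`-module is a
`T'`-linear retract of a finite product `Π j : Fin n, S' (a j)` of members of the family (the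
(IW-p)-shaped class inclusion `Ωᵐ(mod T') ⊆ add S'`), then `y ∈ caᵐ⁺¹(T')`: the product is stably
annihilated (`StablyAnnihilates.pi`), retracts inherit (`StablyAnnihilates.of_retract_linearMap`), CA1
backward. [cite: IyengarTakahashi2014, Remark 2.13] -/
theorem mem_cohomologyAnnihilatorOfDegree_succ_of_addCover {T' : Type u} [CommRing T']
    [IsNoetherianRing T'] (m : ℕ) {y : T'} {I : Type*} (S' : I → ModuleCat.{u} T')
    (hS' : ∀ i, StablyAnnihilates T' y (S' i))
    (hIW : ∀ (M L : ModuleCat.{u} T'), Module.Finite T' M → IsSyzygy m M L →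
      ∃ (n : ℕ) (a : Fin n → I) (i : L →ₗ[T'] (Π j, S' (a j))) (r : (Π j, S' (a j)) →ₗ[T'] L),
        r ∘ₗ i = LinearMap.id) :
    y ∈ cohomologyAnnihilatorOfDegree T' (m + 1) := by
  refine (mem_cohomologyAnnihilatorOfDegree_succ_iff_forall_isSyzygy _).mpr fun M L hM hL => ?_
  obtain ⟨n, a, i, r, hri⟩ := hIW M L hM hL
  have hpi : StablyAnnihilates T' y (ModuleCat.of T' (Π j, S' (a j))) :=
    StablyAnnihilates.pi (fun j => (S' (a j) : Type u)) fun j => hS' (a j)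
  exact StablyAnnihilates.of_retract_linearMap hpi i r hri

/-- **Target side of (R4), with a free factor in the cover** (`add (S' ∪ {T'})`): if every `m`-th
syzygy over the noetherian `T'` is a `T'`-linear retract of `(Fin b → T') × Π j : Fin n, S' (a j)` with
every `S' i` stably annihilated by `y`, then `y ∈ caᵐ⁺¹(T')` (free modules are stably annihilated by
everything, `StablyAnnihilates.fin`). [cite: IyengarTakahashi2014, Remark 2.13] -/
theorem mem_cohomologyAnnihilatorOfDegree_succ_of_addCover' {T' : Type u} [CommRing T']
    [IsNoetherianRing T'] (m : ℕ) {y : T'} {I : Type*} (S' : I → ModuleCat.{u} T')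
    (hS' : ∀ i, StablyAnnihilates T' y (S' i))
    (hIW : ∀ (M L : ModuleCat.{u} T'), Module.Finite T' M → IsSyzygy m M L →
      ∃ (b n : ℕ) (a : Fin n → I) (i : L →ₗ[T'] ((Fin b → T') × (Π j, S' (a j))))
        (r : ((Fin b → T') × (Π j, S' (a j))) →ₗ[T'] L), r ∘ₗ i = LinearMap.id) :
    y ∈ cohomologyAnnihilatorOfDegree T' (m + 1) := by
  refine (mem_cohomologyAnnihilatorOfDegree_succ_iff_forall_isSyzygy _).mpr fun M L hM hL => ?_
  obtain ⟨b, n, a, i, r, hri⟩ := hIW M L hM hL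
  have hpi : StablyAnnihilates T' y (ModuleCat.of T' ((Fin b → T') × (Π j, S' (a j)))) :=
    StablyAnnihilates.prod (StablyAnnihilates.fin y b)
      (StablyAnnihilates.pi (fun j => (S' (a j) : Type u)) fun j => hS' (a j))
  exact StablyAnnihilates.of_retract_linearMap hpi i r hri

/-! ## (E-sur), abstract form: members of the target family are retracts of products of tensor hulls -/

/-- **(E-sur) with tensor hulls ⇒ the target family is reached.** For an algebra `T → T'` and a family
`S' : I → ModuleCat T'`: if every `S' i` is a `T'`-linear retract of a finite product
`Π j : Fin n, (T' ⊗_T N j)**` of reflexive hulls of base changes of `T`-modules `N j` that `x : T`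
stably annihilates, then `algebraMap T T' x` stably annihilates every `S' i`
(`StablyAnnihilates.dual_dual_baseChange`, `.pi`, `.of_retract_linearMap`). [folklore] -/
theorem stablyAnnihilates_family_of_tensorHullCover {T T' : Type u} [CommRing T] [CommRing T']
    [Algebra T T'] {x : T} {I : Type*} (S' : I → ModuleCat.{u} T')
    (hEsur : ∀ i, ∃ (n : ℕ) (N : Fin n → ModuleCat.{u} T), (∀ j, StablyAnnihilates T x (N j)) ∧
      ∃ (ι : S' i →ₗ[T'] (Π j, Module.Dual T' (Module.Dual T' (T' ⊗[T] N j))))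
        (r : (Π j, Module.Dual T' (Module.Dual T' (T' ⊗[T] N j))) →ₗ[T'] S' i),
        r ∘ₗ ι = LinearMap.id) (i : I) :
    StablyAnnihilates T' (algebraMap T T' x) (S' i) := by
  obtain ⟨n, N, hN, ι, r, hrι⟩ := hEsur i
  have hpi : StablyAnnihilates T' (algebraMap T T' x)
      (ModuleCat.of T' (Π j, Module.Dual T' (Module.Dual T' (T' ⊗[T] N j)))) :=
    StablyAnnihilates.pi (fun j => Module.Dual T' (Module.Dual T' (T' ⊗[T] N j)))
      fun j => StablyAnnihilates.dual_dual_baseChange (hN j)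
  exact StablyAnnihilates.of_retract_linearMap hpi ι r hrι

/-- **The (R4) assembly, abstract form: `caᵐ⁺¹(T) · T' ⊆ caᵐ⁺¹(T')` from (IW-p) + (E-sur).** `T`, `T'`
noetherian, `T → T'` an algebra, `S' : I → ModuleCat T'` the target family. (IW-p)-shape: every `m`-th
syzygy over `T'` is a retract of `(Fin b → T') × Π j, S' (a j)`; (E-sur)-shape: every `S' i` is a
retract of `Π j, (T' ⊗_T N j)**` with each `N j` an `m`-th syzygy of a finitely generated `T`-module.
Then `(caᵐ⁺¹ T).map (algebraMap T T') ≤ caᵐ⁺¹ T'`: for `x ∈ caᵐ⁺¹(T)`, CA1 forward makes `x` stably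
annihilate each `N j` (HC-0), (E-sur) transports to the family, (IW-p) to every `m`-th syzygy over
`T'`, CA1 backward. Both hypotheses are free of `x`. [cite: IyengarTakahashi2014, Remark 2.13] -/
theorem map_cohomologyAnnihilatorOfDegree_succ_le_of_tensorHullCover {T T' : Type u} [CommRing T]
    [CommRing T'] [IsNoetherianRing T] [IsNoetherianRing T'] [Algebra T T'] (m : ℕ) {I : Type*}
    (S' : I → ModuleCat.{u} T')
    (hIW : ∀ (M L : ModuleCat.{u} T'), Module.Finite T' M → IsSyzygy m M L →
      ∃ (b n : ℕ) (a : Fin n → I) (i : L →ₗ[T'] ((Fin b → T') × (Π j, S' (a j))))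
        (r : ((Fin b → T') × (Π j, S' (a j))) →ₗ[T'] L), r ∘ₗ i = LinearMap.id)
    (hEsur : ∀ i, ∃ (n : ℕ) (N : Fin n → ModuleCat.{u} T),
      (∀ j, ∃ M : ModuleCat.{u} T, Module.Finite T M ∧ IsSyzygy m M (N j)) ∧
      ∃ (ι : S' i →ₗ[T'] (Π j, Module.Dual T' (Module.Dual T' (T' ⊗[T] N j))))
        (r : (Π j, Module.Dual T' (Module.Dual T' (T' ⊗[T] N j))) →ₗ[T'] S' i),
        r ∘ₗ ι = LinearMap.id) :
    (cohomologyAnnihilatorOfDegree T (m + 1)).map (algebraMap T T') ≤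
      cohomologyAnnihilatorOfDegree T' (m + 1) := by
  rw [Ideal.map_le_iff_le_comap]
  intro x hx
  refine Ideal.mem_comap.mpr (mem_cohomologyAnnihilatorOfDegree_succ_of_addCover' m S' ?_ hIW)
  refine stablyAnnihilates_family_of_tensorHullCover S' fun i => ?_
  obtain ⟨n, N, hN, ι, r, hrι⟩ := hEsur i
  refine ⟨n, N, fun j => ?_, ι, r, hrι⟩
  obtain ⟨M, hM, hsyz⟩ := hN j
  exact stablyAnnihilates_of_mem_cohomologyAnnihilatorOfDegree_succ hx M (N j) hM hsyz

/-! ## (E-sur), birational form: span hulls `reflexiveHull (C · Y₀)` of lattices, `B ≤ C ≤ K`, `C ⊆ Frac B` -/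

section Subalgebra

variable {k : Type*} {K : Type u} [CommRing k] [Field K] [Algebra k K] {B C : Subalgebra k K}

/-- **One span hull.** Subalgebras `B ≤ C` of a field `K` with `C ⊆ Frac B` inside `K`; `Y₀ ⊆ V` a
`↥B`-submodule of a `K`-vector space whose `↥C`-span `Y` is finitely generated. If `c : B` stably
annihilates `Y₀` over `B`, then `c ∈ C` stably annihilates the reflexive hull `reflexiveHull Y ⊆ V` over
`C` — the hull lemma `Subalgebra.exists_comp_eq_smul_id_reflexiveHull_of_le_of_span_eq` (idea-2) read
through the bridge `stablyAnnihilates_iff_exists_linearMap`. [cite: BrunsHerzog1998, Prop. 1.4.1] -/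
theorem Subalgebra.stablyAnnihilates_reflexiveHull_span (hBC : B ≤ C)
    (hfrac : ∀ s ∈ C, ∃ b ∈ B, b ≠ 0 ∧ b * s ∈ B)
    {V : Type u} [AddCommGroup V] [Module K V] {Y₀ : Submodule B V} {Y : Submodule C V}
    (hY : Submodule.span C (Y₀ : Set V) = Y) [Module.Finite C Y] {c : B}
    (h : StablyAnnihilates B c (ModuleCat.of B Y₀)) :
    StablyAnnihilates C (Subalgebra.inclusion hBC c) (ModuleCat.of C (reflexiveHull Y)) := by
  obtain ⟨s, ι₀, π₀, h₀⟩ := (stablyAnnihilates_iff_exists_linearMap c (ModuleCat.of B Y₀)).mp h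
  obtain ⟨ι, π, hιπ⟩ :=
    Subalgebra.exists_comp_eq_smul_id_reflexiveHull_of_le_of_span_eq hBC hfrac hY ι₀ π₀ h₀
  exact stablyAnnihilates_of_linearMap ι π hιπ

/-- The `↥C`-span of a finitely generated `↥B`-lattice is finitely generated (`B ≤ C`):
`span_C Y₀ = span_C s` for a finite `↥B`-generating set `s` of `Y₀` (`Submodule.span_span_of_tower`).
[folklore] -/
theorem Subalgebra.finite_span_of_finite (hBC : B ≤ C) {V : Type u} [AddCommGroup V] [Module K V]
    (Y₀ : Submodule B V) [Module.Finite B Y₀] :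
    Module.Finite C (Submodule.span C (Y₀ : Set V)) := by
  letI := (Subalgebra.inclusion hBC).toRingHom.toAlgebra
  haveI := Subalgebra.isScalarTower_inclusion hBC
  haveI : IsScalarTower B C V := Subalgebra.isScalarTower_module (B := B) (C := C) V
  have hY₀ : (Y₀ : Submodule B V).FG := (Submodule.fg_top Y₀).mp Module.Finite.fg_top
  obtain ⟨t, ht⟩ := hY₀
  rw [Module.Finite.iff_fg, ← ht, Submodule.span_span_of_tower]
  exact Submodule.fg_span t.finite_toSet

/-- **(E-sur) with span hulls ⇒ the target family is reached.** Subalgebras `B ≤ C` of a field `K`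
with `C ⊆ Frac B`; `S' : I → ModuleCat ↥C` a target family. If every `S' i` is a `↥C`-linear retract of
a finite product `Π j : Fin n, reflexiveHull (C · Y₀ j)` of span hulls of finitely generated
`↥B`-lattices `Y₀ j ⊆ V j` (in `K`-vector spaces) that `c : B` stably annihilates over `B`, then `c ∈ C`
stably annihilates every `S' i`. [cite: BrunsHerzog1998, Prop. 1.4.1] -/
theorem Subalgebra.stablyAnnihilates_family_of_spanHullCover (hBC : B ≤ C)
    (hfrac : ∀ s ∈ C, ∃ b ∈ B, b ≠ 0 ∧ b * s ∈ B) {c : B} {I : Type*} (S' : I → ModuleCat.{u} C)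
    (hEsur : ∀ i, ∃ (n : ℕ) (V : Fin n → Type u) (_ : ∀ j, AddCommGroup (V j))
      (_ : ∀ j, Module K (V j)) (Y₀ : ∀ j, Submodule B (V j)),
      (∀ j, Module.Finite B (Y₀ j) ∧ StablyAnnihilates B c (ModuleCat.of B (Y₀ j))) ∧
      ∃ (ι : S' i →ₗ[C] (Π j, reflexiveHull (Submodule.span C (Y₀ j : Set (V j)))))
        (r : (Π j, reflexiveHull (Submodule.span C (Y₀ j : Set (V j)))) →ₗ[C] S' i),
        r ∘ₗ ι = LinearMap.id) (i : I) :
    StablyAnnihilates C (Subalgebra.inclusion hBC c) (S' i) := by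
  obtain ⟨n, V, _, _, Y₀, hY₀, ι, r, hrι⟩ := hEsur i
  have hpi : StablyAnnihilates C (Subalgebra.inclusion hBC c)
      (ModuleCat.of C (Π j, reflexiveHull (Submodule.span C (Y₀ j : Set (V j))))) := by
    refine StablyAnnihilates.pi (fun j => reflexiveHull (Submodule.span C (Y₀ j : Set (V j))))
      fun j => ?_
    haveI := (hY₀ j).1
    haveI := Subalgebra.finite_span_of_finite hBC (Y₀ j)
    exact Subalgebra.stablyAnnihilates_reflexiveHull_span hBC hfrac rfl (hY₀ j).2
  exact StablyAnnihilates.of_retract_linearMap hpi ι r hrι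

/-- **The (R4) assembly, birational form, one element.** Subalgebras `B ≤ C` of a field `K`, both
noetherian, with `C ⊆ Frac B` inside `K` (one birational tower step `T_m ⊆ T_(m+1)`); a target family
`S' : I → ModuleCat ↥C`. (IW-p)-shape `hIW`: every `m`-th syzygy of a finitely generated `↥C`-module is a
`↥C`-linear retract of `(Fin b → C) × Π j, S' (a j)`. (E-sur)-shape `hEsur`: every `S' i` is a
`↥C`-linear retract of `Π j, reflexiveHull (C · Y₀ j)` for `↥B`-lattices `Y₀ j ⊆ V j` each of which is
an `m`-th syzygy of a finitely generated `↥B`-module. Then `c ∈ caᵐ⁺¹(B) ⇒ c ∈ caᵐ⁺¹(C)`: CA1 forward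
(the `Y₀ j` are finitely generated by `finite_of_isSyzygy` and stably annihilated by `c`), birational
transfer + hull lemma to the span hulls, (E-sur) to the family, (IW-p) to every `m`-th syzygy, CA1
backward — exponent one throughout. [cite: IyengarTakahashi2014, Remark 2.13] -/
theorem Subalgebra.inclusion_mem_cohomologyAnnihilatorOfDegree_succ_of_spanHullCover (hBC : B ≤ C)
    (hfrac : ∀ s ∈ C, ∃ b ∈ B, b ≠ 0 ∧ b * s ∈ B) [IsNoetherianRing B] [IsNoetherianRing C]
    (m : ℕ) {I : Type*} (S' : I → ModuleCat.{u} C)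
    (hIW : ∀ (M L : ModuleCat.{u} C), Module.Finite C M → IsSyzygy m M L →
      ∃ (b n : ℕ) (a : Fin n → I) (i : L →ₗ[C] ((Fin b → C) × (Π j, S' (a j))))
        (r : ((Fin b → C) × (Π j, S' (a j))) →ₗ[C] L), r ∘ₗ i = LinearMap.id)
    (hEsur : ∀ i, ∃ (n : ℕ) (V : Fin n → Type u) (_ : ∀ j, AddCommGroup (V j))
      (_ : ∀ j, Module K (V j)) (Y₀ : ∀ j, Submodule B (V j)),
      (∀ j, ∃ M : ModuleCat.{u} B, Module.Finite B M ∧ IsSyzygy m M (ModuleCat.of B (Y₀ j))) ∧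
      ∃ (ι : S' i →ₗ[C] (Π j, reflexiveHull (Submodule.span C (Y₀ j : Set (V j)))))
        (r : (Π j, reflexiveHull (Submodule.span C (Y₀ j : Set (V j)))) →ₗ[C] S' i),
        r ∘ₗ ι = LinearMap.id)
    {c : B} (hc : c ∈ cohomologyAnnihilatorOfDegree B (m + 1)) :
    Subalgebra.inclusion hBC c ∈ cohomologyAnnihilatorOfDegree C (m + 1) := by
  refine mem_cohomologyAnnihilatorOfDegree_succ_of_addCover' m S' ?_ hIW
  refine Subalgebra.stablyAnnihilates_family_of_spanHullCover hBC hfrac S' fun i => ?_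
  obtain ⟨n, V, _, _, Y₀, hY₀, ι, r, hrι⟩ := hEsur i
  refine ⟨n, V, inferInstance, inferInstance, Y₀, fun j => ?_, ι, r, hrι⟩
  obtain ⟨M, hM, hsyz⟩ := hY₀ j
  exact ⟨finite_of_isSyzygy m hM hsyz,
    stablyAnnihilates_of_mem_cohomologyAnnihilatorOfDegree_succ hc M _ hM hsyz⟩

/-- **The (R4) assembly, birational form, as an inclusion of ideals**: under (IW-p) + (E-sur) as in
`Subalgebra.inclusion_mem_cohomologyAnnihilatorOfDegree_succ_of_spanHullCover`,
`(caᵐ⁺¹ B).map (Subalgebra.inclusion hBC) ≤ caᵐ⁺¹ C`. [cite: IyengarTakahashi2014, Remark 2.13] -/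
theorem Subalgebra.map_cohomologyAnnihilatorOfDegree_succ_le_of_spanHullCover (hBC : B ≤ C)
    (hfrac : ∀ s ∈ C, ∃ b ∈ B, b ≠ 0 ∧ b * s ∈ B) [IsNoetherianRing B] [IsNoetherianRing C]
    (m : ℕ) {I : Type*} (S' : I → ModuleCat.{u} C)
    (hIW : ∀ (M L : ModuleCat.{u} C), Module.Finite C M → IsSyzygy m M L →
      ∃ (b n : ℕ) (a : Fin n → I) (i : L →ₗ[C] ((Fin b → C) × (Π j, S' (a j))))
        (r : ((Fin b → C) × (Π j, S' (a j))) →ₗ[C] L), r ∘ₗ i = LinearMap.id)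
    (hEsur : ∀ i, ∃ (n : ℕ) (V : Fin n → Type u) (_ : ∀ j, AddCommGroup (V j))
      (_ : ∀ j, Module K (V j)) (Y₀ : ∀ j, Submodule B (V j)),
      (∀ j, ∃ M : ModuleCat.{u} B, Module.Finite B M ∧ IsSyzygy m M (ModuleCat.of B (Y₀ j))) ∧
      ∃ (ι : S' i →ₗ[C] (Π j, reflexiveHull (Submodule.span C (Y₀ j : Set (V j)))))
        (r : (Π j, reflexiveHull (Submodule.span C (Y₀ j : Set (V j)))) →ₗ[C] S' i),
        r ∘ₗ ι = LinearMap.id) :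
    (cohomologyAnnihilatorOfDegree B (m + 1)).map (Subalgebra.inclusion hBC).toRingHom ≤
      cohomologyAnnihilatorOfDegree C (m + 1) := by
  rw [Ideal.map_le_iff_le_comap]
  intro c hc
  exact Ideal.mem_comap.mpr
    (Subalgebra.inclusion_mem_cohomologyAnnihilatorOfDegree_succ_of_spanHullCover hBC hfrac m S' hIW
      hEsur hc)

/-- **LEVEL 3 — the literal (R4) shape** (`m = 2` of
`Subalgebra.inclusion_mem_cohomologyAnnihilatorOfDegree_succ_of_spanHullCover`, named for the consumers of
programme M-rat). Subalgebras `B ≤ C` of a field `K`, both noetherian, with `C ⊆ Frac B`; target family `S'`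
over `C` (at a rational surface stage: the special reflexive modules of `T_(m+1)` and their duals).
(IW-p): every SECOND syzygy over `C` is a retract of `(Fin b → C) × Π j, S' (a j)`; (E-sur): every `S' i`
is a retract of `Π j, reflexiveHull (C · Y₀ j)` for `↥B`-lattices `Y₀ j` that are second syzygies of
finitely generated `↥B`-modules (e.g. finitely generated reflexive lattices — the specials of `T_m` —
by `exists_isSyzygy_two_of_isReflexive`). Then `c ∈ ca³(B) ⇒ c ∈ ca³(C)`.
[cite: IyengarTakahashi2014, Remark 2.13; BrunsHerzog1998, Prop. 1.4.1] -/
theorem Subalgebra.inclusion_mem_cohomologyAnnihilatorOfDegree_three_of_spanHullCover (hBC : B ≤ C)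
    (hfrac : ∀ s ∈ C, ∃ b ∈ B, b ≠ 0 ∧ b * s ∈ B) [IsNoetherianRing B] [IsNoetherianRing C]
    {I : Type*} (S' : I → ModuleCat.{u} C)
    (hIW : ∀ (M L : ModuleCat.{u} C), Module.Finite C M → IsSyzygy 2 M L →
      ∃ (b n : ℕ) (a : Fin n → I) (i : L →ₗ[C] ((Fin b → C) × (Π j, S' (a j))))
        (r : ((Fin b → C) × (Π j, S' (a j))) →ₗ[C] L), r ∘ₗ i = LinearMap.id)
    (hEsur : ∀ i, ∃ (n : ℕ) (V : Fin n → Type u) (_ : ∀ j, AddCommGroup (V j))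
      (_ : ∀ j, Module K (V j)) (Y₀ : ∀ j, Submodule B (V j)),
      (∀ j, ∃ M : ModuleCat.{u} B, Module.Finite B M ∧ IsSyzygy 2 M (ModuleCat.of B (Y₀ j))) ∧
      ∃ (ι : S' i →ₗ[C] (Π j, reflexiveHull (Submodule.span C (Y₀ j : Set (V j)))))
        (r : (Π j, reflexiveHull (Submodule.span C (Y₀ j : Set (V j)))) →ₗ[C] S' i),
        r ∘ₗ ι = LinearMap.id)
    {c : B} (hc : c ∈ cohomologyAnnihilatorOfDegree B 3) :
    Subalgebra.inclusion hBC c ∈ cohomologyAnnihilatorOfDegree C 3 :=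
  Subalgebra.inclusion_mem_cohomologyAnnihilatorOfDegree_succ_of_spanHullCover hBC hfrac 2 S' hIW hEsur hc

end Subalgebra


/-! ## Appendix — level 3 with reflexive source lattices -/

section ReflexiveAppendix

open Summit.ResolutionOfSingularities.ResolutionOfSingularities.Theorems.HomologicalConductor.PersistenceConductorCeiling

variable {k : Type*} {K : Type u} [CommRing k] [Field K] [Algebra k K] {B C : Subalgebra k K}

/-- **LEVEL 3 with REFLEXIVE source lattices — the literal (R4) shape.** Subalgebras `B ≤ C` of a field
`K`, both noetherian, with `C ⊆ Frac B`; target family `S'` over `C` (at a rational surface stage: the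
special reflexive modules of `T_(m+1)` and their duals). (IW-p): every SECOND syzygy over `C` is a retract
of `(Fin b → C) × Π j, S' (a j)`; (E-sur): every `S' i` is a retract of `Π j, reflexiveHull (C · Y₀ j)` for
finitely generated REFLEXIVE `↥B`-lattices `Y₀ j` (the specials of `T_m` are reflexive). Then
`c ∈ ca³(B) ⇒ c ∈ ca³(C)`. A finitely generated reflexive module over a noetherian ring is a second syzygy
(`exists_isSyzygy_two_of_isReflexive`, lead-1 p553024), so this is
`Subalgebra.inclusion_mem_cohomologyAnnihilatorOfDegree_three_of_spanHullCover`.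
[cite: IyengarTakahashi2014, Remark 2.13; BrunsHerzog1998, Prop. 1.4.1] -/
theorem Subalgebra.inclusion_mem_cohomologyAnnihilatorOfDegree_three_of_reflexiveSpanHullCover
    (hBC : B ≤ C) (hfrac : ∀ s ∈ C, ∃ b ∈ B, b ≠ 0 ∧ b * s ∈ B) [IsNoetherianRing B]
    [IsNoetherianRing C] {I : Type*} (S' : I → ModuleCat.{u} C)
    (hIW : ∀ (M L : ModuleCat.{u} C), Module.Finite C M → IsSyzygy 2 M L →
      ∃ (b n : ℕ) (a : Fin n → I) (i : L →ₗ[C] ((Fin b → C) × (Π j, S' (a j))))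
        (r : ((Fin b → C) × (Π j, S' (a j))) →ₗ[C] L), r ∘ₗ i = LinearMap.id)
    (hEsur : ∀ i, ∃ (n : ℕ) (V : Fin n → Type u) (_ : ∀ j, AddCommGroup (V j))
      (_ : ∀ j, Module K (V j)) (Y₀ : ∀ j, Submodule B (V j)),
      (∀ j, Module.Finite B (Y₀ j) ∧ Module.IsReflexive B (Y₀ j)) ∧
      ∃ (ι : S' i →ₗ[C] (Π j, reflexiveHull (Submodule.span C (Y₀ j : Set (V j)))))
        (r : (Π j, reflexiveHull (Submodule.span C (Y₀ j : Set (V j)))) →ₗ[C] S' i),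
        r ∘ₗ ι = LinearMap.id)
    {c : B} (hc : c ∈ cohomologyAnnihilatorOfDegree B 3) :
    Subalgebra.inclusion hBC c ∈ cohomologyAnnihilatorOfDegree C 3 := by
  refine Subalgebra.inclusion_mem_cohomologyAnnihilatorOfDegree_three_of_spanHullCover hBC hfrac S' hIW
    (fun i => ?_) hc
  obtain ⟨n, V, _, _, Y₀, hY₀, ι, r, hrι⟩ := hEsur i
  refine ⟨n, V, inferInstance, inferInstance, Y₀, fun j => ?_, ι, r, hrι⟩
  haveI := (hY₀ j).1
  haveI := (hY₀ j).2
  exact exists_isSyzygy_two_of_isReflexive (A := B) (Y₀ j)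

end ReflexiveAppendix

end Summit.ResolutionOfSingularities.ResolutionOfSingularities.Theorems.HomologicalConductor.PersistenceSurfaceSpecialCoverAssembly

end
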